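import Summits.Parity.GeneralizedHardyLittlewood.Theorems.PsiGradedTablesClosePoly.Negative.DarkCellsNoClosing
import HarnessLib

/-!
# Negative lane of `PsiGradedTablesClosePoly` (h2′): a UNIFORM WRAP BOUND kills the sign test ON the class —
# cells of modulus `≤ ½√(𝔅(f)𝔅(g))` everywhere on `𝒞` ⇒ no closing on `𝒞` (scaled Gershgorin; constant `½` TIGHT)

Y. Zhang, *Discrete mean estimates and the Landau–Siegel zero*, arXiv:2211.02515v1 [Zhang2022LandauSiegel] — an
unrefereed manuscript under adjudication; nothing here asserts any of its claims and nothing here is a statement about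
Landau–Siegel zeros. Desk lemma of the §G referee (ls-ref-1) — the kernel instrument for the T0+48h kill criterion
«wrap (U) vs F1-THRESHOLD on every long sub-unit poly design», (A)-free:

* `two_re_cross_ge_scaled` — `4|u|² ≤ 𝔅ᵢ𝔅ⱼ ⇒ −(𝔅ᵢ|z|² + 𝔅ⱼ|w|²)/2 ≤ 2Re(z·conj(w·u))` (AM–GM, square-root free);
* `gradedQuadForm_nonneg_of_cells_le_half_geom` — at a design where each of the three cells satisfies
  `4‖cell‖² ≤ 𝔅·𝔅` of its two legs (and the three `𝔅 ≥ 0`), the graded form is `≥ 0` at every amplitude;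
* **`not_gradedClosesOn_of_cells_le_half_geom`** — if `4‖X₁(u,v)‖² ≤ 𝔅(u)𝔅(v)`, `4‖Y₁(u,v)‖² ≤ 𝔅(u)𝔅(v)`,
  `4‖X₂(u,v)‖² ≤ 𝔅(u)𝔅(v)` for all in-class `u, v` with `𝒞 u u' v v'`, then `¬ GradedClosesOn 𝒞 X₁ Y₁ X₂`: a displayed
  wrap term bounded by HALF THE GEOMETRIC MEAN of the diagonal forms, uniformly on the sub-unit poly class, makes h2′'s
  sign test FAIL on that class — by name. The constant `½` cannot be improved: the coherent triple closes as soon as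
  `t > 𝔅/2` (`DetClosesOn.coherentTriple_closesAt_iff`, crit-1 p589046);
* `not_gradedClosesOn_of_cells_le_half_geom'` — the same with the hypothesis in the form `‖cell‖ ≤ c·√𝔅(u)·√𝔅(v)`, `c ≤ ½`.

It generalises `not_gradedClosesOn_of_darkOn` (cells `0`) and complements `exists_row_excess_of_gradedClosesOn`
(absolute row masses). No Theses statement asserted; no new `Prop`; axioms standard.
-/

noncomputable section

open Complex Real ComplexConjugate

namespace Summit.Parity.GeneralizedHardyLittlewood.Theorems.PsiGradedTablesClosePoly.Negative

open Literature.NumberTheory.LFunctions.Zhang2022 Literature.NumberTheory.LFunctions.Zhang2022.KnifeEdge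
open Literature.NumberTheory.LFunctions.Zhang2022.Repair

/-! ### Part 1 — the scaled cross-term bound (pure algebra) -/

/-- Square-root-free AM–GM for the cross term: `4|u|² ≤ BᵢBⱼ`, `Bᵢ, Bⱼ ≥ 0` ⇒ `−(Bᵢ|z|² + Bⱼ|w|²)/2 ≤ 2Re(z·conj(w·u))`. [folklore] -/
theorem two_re_cross_ge_scaled (z w u : ℂ) {Bi Bj : ℝ} (hBi : 0 ≤ Bi) (hBj : 0 ≤ Bj) (hu : 4 * ‖u‖ ^ 2 ≤ Bi * Bj) :
    -((Bi * ‖z‖ ^ 2 + Bj * ‖w‖ ^ 2) / 2) ≤ 2 * (z * conj (w * u)).re := by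
  have h1 : |(z * conj (w * u)).re| ≤ ‖z * conj (w * u)‖ := Complex.abs_re_le_norm _
  have h2 : ‖z * conj (w * u)‖ = ‖z‖ * (‖w‖ * ‖u‖) := by simp
  have h3 := (abs_le.mp h1).1
  rw [h2] at h3
  -- 4·|z||w||u| ≤ Bᵢ|z|² + Bⱼ|w|²: compare squares (both sides non-negative)
  have hP : 0 ≤ Bi * ‖z‖ ^ 2 + Bj * ‖w‖ ^ 2 := by positivity
  have hkey : 4 * (‖z‖ * (‖w‖ * ‖u‖)) ≤ Bi * ‖z‖ ^ 2 + Bj * ‖w‖ ^ 2 := by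
    by_contra hlt
    push Not at hlt
    have hsq := mul_self_lt_mul_self hP hlt
    nlinarith [sq_nonneg (Bi * ‖z‖ ^ 2 - Bj * ‖w‖ ^ 2), mul_nonneg (mul_nonneg (sq_nonneg ‖z‖) (sq_nonneg ‖w‖)) (sub_nonneg.mpr hu),
      norm_nonneg z, norm_nonneg w, norm_nonneg u]
  linarith

variable {X₁ Y₁ X₂ : PairFunctional} {f f' g₁ g₁' g₂ g₂' : ℝ → ℂ} {𝒞 : PairClass}

/-- **Scaled Gershgorin (proved, (A)-free):** if at a design the three cells satisfy `4‖X₁(f,g₁)‖² ≤ 𝔅(f)𝔅(g₁)`,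
`4‖X₂(f,g₂)‖² ≤ 𝔅(f)𝔅(g₂)`, `4‖Y₁(g₁,g₂)‖² ≤ 𝔅(g₁)𝔅(g₂)` and the diagonal forms are `≥ 0`, then the graded form is
non-negative at every amplitude vector. [cite: Zhang2022LandauSiegel, §2 (2.16)–(2.17)] -/
theorem gradedQuadForm_nonneg_of_cells_le_half_geom (hB0 : 0 ≤ mainTermForm f f') (hB1 : 0 ≤ mainTermForm g₁ g₁')
    (hB2 : 0 ≤ mainTermForm g₂ g₂') (h01 : 4 * ‖X₁ f f' g₁ g₁'‖ ^ 2 ≤ mainTermForm f f' * mainTermForm g₁ g₁')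
    (h02 : 4 * ‖X₂ f f' g₂ g₂'‖ ^ 2 ≤ mainTermForm f f' * mainTermForm g₂ g₂')
    (h12 : 4 * ‖Y₁ g₁ g₁' g₂ g₂'‖ ^ 2 ≤ mainTermForm g₁ g₁' * mainTermForm g₂ g₂') (s : Fin 3 → ℂ) :
    0 ≤ gradedQuadForm (gradedMainMatrix X₁ Y₁ X₂ f f' g₁ g₁' g₂ g₂') s := by
  rw [gradedQuadForm_eq]
  have k01 := two_re_cross_ge_scaled (s 0) (s 1) (X₁ f f' g₁ g₁') hB0 hB1 h01
  have k12 := two_re_cross_ge_scaled (s 1) (s 2) (Y₁ g₁ g₁' g₂ g₂') hB1 hB2 h12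
  have k02 := two_re_cross_ge_scaled (s 0) (s 2) (X₂ f f' g₂ g₂') hB0 hB2 h02
  nlinarith [k01, k12, k02]

/-! ### Part 2 — a uniform half-geometric-mean bound on the class kills closing on the class -/

/-- **UNIFORM WRAP BOUND ⇒ NO CLOSING ON THE CLASS (proved, (A)-free):** if every cell of the three tables is at most
half the geometric mean of the diagonal forms of its legs — `4‖X(u,v)‖² ≤ 𝔅(u)𝔅(v)` for all in-class `u, v` with
`𝒞 u u' v v'`, for `X ∈ {X₁, Y₁, X₂}` — then `¬ GradedClosesOn 𝒞 X₁ Y₁ X₂`. The constant `½` is sharp (coherent triple,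
`DetClosesOn.coherentTriple_closesAt_iff`). [cite: Zhang2022LandauSiegel, §2 (2.16)–(2.17), §7 Prop 7.1 (7.2)] -/
theorem not_gradedClosesOn_of_cells_le_half_geom
    (hX₁ : ∀ u u' v v', InClassPiece u u' → InClassPiece v v' → 𝒞 u u' v v' →
      4 * ‖X₁ u u' v v'‖ ^ 2 ≤ mainTermForm u u' * mainTermForm v v')
    (hY₁ : ∀ u u' v v', InClassPiece u u' → InClassPiece v v' → 𝒞 u u' v v' →
      4 * ‖Y₁ u u' v v'‖ ^ 2 ≤ mainTermForm u u' * mainTermForm v v')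
    (hX₂ : ∀ u u' v v', InClassPiece u u' → InClassPiece v v' → 𝒞 u u' v v' →
      4 * ‖X₂ u u' v v'‖ ^ 2 ≤ mainTermForm u u' * mainTermForm v v') :
    ¬ GradedClosesOn 𝒞 X₁ Y₁ X₂ := by
  rintro ⟨f, f', g₁, g₁', g₂, g₂', s, hf, hg₁, hg₂, h01, h02, h12, hneg⟩
  have hB0 := mainTermForm_nonneg_of_isH1 hf.kinked.isH1
  have hB1 := mainTermForm_nonneg_of_isH1 hg₁.kinked.isH1
  have hB2 := mainTermForm_nonneg_of_isH1 hg₂.kinked.isH1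
  have := gradedQuadForm_nonneg_of_cells_le_half_geom hB0 hB1 hB2 (hX₁ _ _ _ _ hf hg₁ h01) (hX₂ _ _ _ _ hf hg₂ h02)
    (hY₁ _ _ _ _ hg₁ hg₂ h12) s
  linarith

/-- The same with the bound in the multiplicative form `‖X(u,v)‖ ≤ c·√𝔅(u)·√𝔅(v)` with one constant `0 ≤ c ≤ ½` for all
three tables (the shape a displayed wrap estimate takes). [cite: Zhang2022LandauSiegel, §2 (2.16)–(2.17), §7 Prop 7.1 (7.2)] -/
theorem not_gradedClosesOn_of_cells_le_half_geom' {c : ℝ} (hc : 0 ≤ c) (hc2 : c ≤ 1 / 2)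
    (hX₁ : ∀ u u' v v', InClassPiece u u' → InClassPiece v v' → 𝒞 u u' v v' →
      ‖X₁ u u' v v'‖ ≤ c * Real.sqrt (mainTermForm u u') * Real.sqrt (mainTermForm v v'))
    (hY₁ : ∀ u u' v v', InClassPiece u u' → InClassPiece v v' → 𝒞 u u' v v' →
      ‖Y₁ u u' v v'‖ ≤ c * Real.sqrt (mainTermForm u u') * Real.sqrt (mainTermForm v v'))
    (hX₂ : ∀ u u' v v', InClassPiece u u' → InClassPiece v v' → 𝒞 u u' v v' →
      ‖X₂ u u' v v'‖ ≤ c * Real.sqrt (mainTermForm u u') * Real.sqrt (mainTermForm v v')) :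
    ¬ GradedClosesOn 𝒞 X₁ Y₁ X₂ := by
  -- from `‖X‖ ≤ c√B(u)√B(v)`, `c ≤ ½`: `4‖X‖² ≤ 4c²B(u)B(v) ≤ B(u)B(v)`
  have conv : ∀ (x Bu Bv : ℝ), 0 ≤ x → 0 ≤ Bu → 0 ≤ Bv → x ≤ c * Real.sqrt Bu * Real.sqrt Bv → 4 * x ^ 2 ≤ Bu * Bv := by
    intro x Bu Bv hx hBu hBv hle
    have hs : (c * Real.sqrt Bu * Real.sqrt Bv) ^ 2 = c ^ 2 * Bu * Bv := by
      rw [mul_pow, mul_pow, Real.sq_sqrt hBu, Real.sq_sqrt hBv]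
    have hx2 : x ^ 2 ≤ (c * Real.sqrt Bu * Real.sqrt Bv) ^ 2 := pow_le_pow_left₀ hx hle 2
    rw [hs] at hx2
    have hc4 : 4 * c ^ 2 ≤ 1 := by nlinarith
    nlinarith [mul_nonneg hBu hBv, mul_le_mul_of_nonneg_right hc4 (mul_nonneg hBu hBv)]
  refine not_gradedClosesOn_of_cells_le_half_geom ?_ ?_ ?_
  · intro u u' v v' hu hv h𝒞
    exact conv _ _ _ (norm_nonneg _) (mainTermForm_nonneg_of_isH1 hu.kinked.isH1)
      (mainTermForm_nonneg_of_isH1 hv.kinked.isH1) (hX₁ u u' v v' hu hv h𝒞)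
  · intro u u' v v' hu hv h𝒞
    exact conv _ _ _ (norm_nonneg _) (mainTermForm_nonneg_of_isH1 hu.kinked.isH1)
      (mainTermForm_nonneg_of_isH1 hv.kinked.isH1) (hY₁ u u' v v' hu hv h𝒞)
  · intro u u' v v' hu hv h𝒞
    exact conv _ _ _ (norm_nonneg _) (mainTermForm_nonneg_of_isH1 hu.kinked.isH1)
      (mainTermForm_nonneg_of_isH1 hv.kinked.isH1) (hX₂ u u' v v' hu hv h𝒞)

end Summit.Parity.GeneralizedHardyLittlewood.Theorems.PsiGradedTablesClosePoly.Negative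

end
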